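import Summits.QuantumFields.BalabanUV.Beta.KernelWardHColumnWall
import Summits.QuantumFields.BalabanUV.Beta.KernelWardMColumn
import Summits.QuantumFields.BalabanUV.Beta.AxialCoordinateProjectorCoarse
import Summits.QuantumFields.BalabanUV.Beta.TameKernelCalculus
import Literature.MathematicalPhysics.QuantumFieldTheory.Balaban1983to89.Beta.BalabanStepW2

/-!
# `BalabanUV.Beta.KernelLegPullback` — binder row D1, hW lane (W-LH) bookkeeping: **THE OUTER-LEG PULL-BACK** — the coarse divergence of the
# right MULTIPLIER leg of `A ∘ K` is `cH ×` the fine block pure gauge on the right FIELD leg of `A`, for any tame `A`, whenever `K`'s ℋ-columns obey the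
# column Ward law with constant `cH` and its multiplier rows are co-closed; instantiated for the wall propagators `G_j = coDressKBmAt ρ Lc (KInvStep Lc j)`
# (β sub-cell, BINDER-OWNERS row D1 OWNER `b2b-balaban-beta-an2`, gen 48; STAGED offer, answer A-an2-g48-1 to gan24-leaf-06's Q-leaf06-g52-1)

HONEST FRAMING (cell charter, verbatim): «discharging BetaPertH makes Bałaban's UV stability UNCONDITIONAL — a real constructive-QFT result; it is
NOT the continuum limit and NOT the Clay problem.»  HONEST DEPENDENCY: continuum YM on T⁴ ⇐ BetaPertH ∧ nine spine estimates (0/9 proved);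
BetaPertH ⇐ (D1) ∧ (D4) ∧ CAP+tail; G-an2-4 gates asym, D1 and NE2/3/4.
NOT IN PRINT; OUR BOOKKEEPING.  [folklore] `tsum`∕`Finset` exchange BY NAME over d1-leaf-07's `KernelWardHColumnWall.colH_ward_KInvStep_all`, an1's
`KernelWardMColumn.colM_coDressKBmAt_KInvStep_ward`, an2's `AxialCoordinateProjectorCoarse`'s `AxialDressingRooted.coDressKBmAt_KInvStep_inr_row_off` and `TameKernelCalculus`;
no statement of Bałaban's papers, no `[cite:]`, no `def`, no `def … : Prop`; instantiates NO binder of the β-function wall.  NOT hW, NOT D1, NOT `BetaPertH`,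
NOT continuum, NOT Clay.

* §1 **`mulLeg_coarseDiv_comp_right`** — ABSTRACT: `A`, `K` tame, `hH : Σ_μ (colH K N μ (y − e_μ) κ′ u − colH K N μ y κ′ u) = cH·gaugeWt N y κ′ u`,
  `hM : Σ_μ (K v (N•(y − e_μ)) (inr ρ) (inr μ) − K v (N•y) (inr ρ) (inr μ)) = 0` (every fine `v`) ⟹
  `Σ_μ ((A∘K) x (N•(y − e_μ)) a (inr μ) − (A∘K) x (N•y) a (inr μ)) = cH · Σ'_v Σ_κ′ A x v a (inl κ′)·gaugeWt N y κ′ v`.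
* §2 **`mulRow_coclosed_coDressKBmAt_KInvStep`** (the fine-form `hM` for `G_j`: off the coarse sublattice the multiplier rows vanish, on it `colM`'s law),
  **`mulLeg_coarseDiv_comp_coDressKBmAt_KInvStep`** — §1 at `K := G_j`, in-block root `r`, `cH = (stepScale d Lc j · Lc^{d+1})⁻¹`, every `j`, every tame `A`.
* §3 (two `private` `rfl` restatements of `WardLocusQuartic.K3OfK_eq` ∕ `GAN24.ExchangeReadout.K2OfK_eq_neg`), **`K3OfK_eq_sandwich`** (`Spr K`, `Loc dM_b`, `Loc dM_{b′}`, `Loc W_{bb′}`: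
  `K3OfK K N S M W b b′ = K ∘ (dM_b∘K∘dM_{b′} + dM_{b′}∘K∘dM_b − W_{bb′}) ∘ K` — every kernel leg of `∂_b∂_{b′}(𝕄⁻¹)` is an OUTER `K` leg), and
  **`mmRead_K3OfK_kernelLeg_coarseDiv`** — THE KERNEL-LEG PULL-BACK OF THE SECOND BOND-DERIVATIVE READ-OUT: the coarse divergence of the right KERNEL leg of
  `mmRead Lc (K3OfK G_j Lc S M W b b′)` (= an2's `e4OfKW Lc G_j S M W b b′`, the E-sector of `T2RecAt (j+1)` up to its weight, `SpineRecursiveW.e4OfKW` `rfl`) is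
  `(stepScale d Lc j · Lc^{d+1})⁻¹ ×` the fine block pure gauge on the right FIELD leg of `G_j ∘ (dM_b∘G_j∘dM_{b′} + dM_{b′}∘G_j∘dM_b − W_{bb′})` — the interior untouched.
Provenance: β sub-cell, unit beta-an2 gen 48, 2026-08-23 (v1); no existing file touched.
-/

open Finset
open scoped BigOperators
open Literature.MathematicalPhysics.QuantumFieldTheory
open Literature.MathematicalPhysics.QuantumFieldTheory.Balaban1983to89
open Literature.MathematicalPhysics.QuantumFieldTheory.Balaban1983to89.Beta
open Literature.Probability.LatticeModels (Torus.proj)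
open LatticeForm (quo)
open ExpKernelCalculus (MKer comp)
open AffineAveraging (box toSite)
open B6BondElimination (unitVec)
open OneStepResolventKernel (Fib eq_zsmul_quo_of_proj)
open OneStepKernelFamily (KInvStep colH)
open SecondOrderResponse (dM K2OfK)
open BalabanStepW2 (K3OfK)
open BalabanStepJetsSucc (mmRead mmRead_inl_inl)
open Summit.QuantumFields.BalabanUV.Beta.TameKernelCalculus
open Summit.QuantumFields.BalabanUV.Beta.AxialDressingRooted (coDressKBmAt spr_coDressKBmAt one_le_of_neZero coDressKBmAt_KInvStep_inr_row_off)
open Summit.QuantumFields.BalabanUV.Beta.BorderedHessian (stepScale spr_KInvStep)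
open Summit.QuantumFields.BalabanUV.Beta.KernelWardRelative (gaugeWt)
open Summit.QuantumFields.BalabanUV.Beta.KernelWardHColumnWall (colH_ward_KInvStep_all)
open Summit.QuantumFields.BalabanUV.Beta.KernelWardMColumn (colM_coDressKBmAt_KInvStep_ward)

namespace Summit.QuantumFields.BalabanUV.Beta.KernelLegPullback

noncomputable section

variable {d : ℕ}

/-! ## §1 The abstract pull-back through the right factor -/

section Abstract

variable {N : ℕ}

/-- [folklore] **THE OUTER-LEG PULL-BACK (right factor)**: for tame `A`, `K`, if the ℋ-columns of `K` obey the column Ward law with constant `cH`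
and the multiplier rows of `K` are co-closed in the source slot, then the coarse divergence of the right MULTIPLIER leg of `A ∘ K` equals `cH` times
the block pure gauge `gaugeWt N y` read on the right FIELD leg of `A`. -/
theorem mulLeg_coarseDiv_comp_right {A K : MKer (d + 1) (Fib d)} (hA : Tame A) (hK : Tame K) {cH : ℝ}
    (hH : ∀ (y : Fin (d + 1) → ℤ) (κ' : Fin (d + 1)) (u : Fin (d + 1) → ℤ),
      ∑ μ, (colH K N μ (y - unitVec μ) κ' u - colH K N μ y κ' u) = cH * gaugeWt N y κ' u)
    (hM : ∀ (v y : Fin (d + 1) → ℤ) (ρ : Fin (d + 1)),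
      ∑ μ, (K v ((N : ℤ) • (y - unitVec μ)) (Sum.inr ρ) (Sum.inr μ) - K v ((N : ℤ) • y) (Sum.inr ρ) (Sum.inr μ)) = 0)
    (x : Fin (d + 1) → ℤ) (a : Fib d) (y : Fin (d + 1) → ℤ) :
    ∑ μ, (comp A K x ((N : ℤ) • (y - unitVec μ)) a (Sum.inr μ) - comp A K x ((N : ℤ) • y) a (Sum.inr μ)) =
      cH * ∑' v, ∑ κ', A x v a (Sum.inl κ') * gaugeWt N y κ' v := by
  -- every slice is summable (tame factors)
  have hs : ∀ (z : Fin (d + 1) → ℤ) (b : Fib d), Summable fun v => ∑ f, A x v a f * K v z f b :=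
    fun z b => slices_tame hA hK x z a b
  have e1 : ∀ μ : Fin (d + 1), comp A K x ((N : ℤ) • (y - unitVec μ)) a (Sum.inr μ) - comp A K x ((N : ℤ) • y) a (Sum.inr μ) =
      ∑' v, ∑ f, A x v a f * (K v ((N : ℤ) • (y - unitVec μ)) f (Sum.inr μ) - K v ((N : ℤ) • y) f (Sum.inr μ)) := by
    intro μ
    show (∑' v, ∑ f, A x v a f * K v ((N : ℤ) • (y - unitVec μ)) f (Sum.inr μ)) -
        (∑' v, ∑ f, A x v a f * K v ((N : ℤ) • y) f (Sum.inr μ)) = _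
    rw [← (hs _ _).tsum_sub (hs _ _)]
    refine tsum_congr fun v => ?_
    rw [← Finset.sum_sub_distrib]
    refine Finset.sum_congr rfl fun f _ => ?_
    ring
  have hs' : ∀ μ : Fin (d + 1), Summable fun v => ∑ f, A x v a f *
      (K v ((N : ℤ) • (y - unitVec μ)) f (Sum.inr μ) - K v ((N : ℤ) • y) f (Sum.inr μ)) := by
    intro μ
    have h := (hs ((N : ℤ) • (y - unitVec μ)) (Sum.inr μ)).sub (hs ((N : ℤ) • y) (Sum.inr μ))
    refine h.congr fun v => ?_
    rw [← Finset.sum_sub_distrib]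
    refine Finset.sum_congr rfl fun f _ => ?_
    ring
  simp_rw [e1]
  rw [← Summable.tsum_finsetSum (fun μ _ => hs' μ), ← tsum_mul_left]
  refine tsum_congr fun v => ?_
  -- pointwise: exchange the two finite sums and apply the two column laws
  have e2 : ∑ μ, ∑ f, A x v a f * (K v ((N : ℤ) • (y - unitVec μ)) f (Sum.inr μ) - K v ((N : ℤ) • y) f (Sum.inr μ)) =
      ∑ f, A x v a f * ∑ μ, (K v ((N : ℤ) • (y - unitVec μ)) f (Sum.inr μ) - K v ((N : ℤ) • y) f (Sum.inr μ)) := by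
    rw [Finset.sum_comm]
    refine Finset.sum_congr rfl fun f _ => ?_
    rw [Finset.mul_sum]
  rw [e2, Fintype.sum_sum_type, Finset.mul_sum]
  have e3 : ∀ κ' : Fin (d + 1), ∑ μ, (K v ((N : ℤ) • (y - unitVec μ)) (Sum.inl κ') (Sum.inr μ) - K v ((N : ℤ) • y) (Sum.inl κ') (Sum.inr μ)) =
      cH * gaugeWt N y κ' v := fun κ' => hH y κ' v
  simp_rw [e3, hM, mul_zero, Finset.sum_const_zero, add_zero]
  refine Finset.sum_congr rfl fun κ' _ => ?_
  ring

end Abstract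

/-! ## §2 The wall propagators `G_j = coDressKBmAt ρ Lc (KInvStep Lc j)` -/

section Wall

variable {Lc : ℕ} [NeZero Lc] {r : Fin (d + 1) → ℕ}

/-- [folklore] **THE MULTIPLIER ROWS OF `G_j` ARE CO-CLOSED IN THE SOURCE SLOT, FINE FORM**: for every fine `v`,
`Σ_μ (G_j v (Lc•(y − e_μ)) (inr ρ′) (inr μ) − G_j v (Lc•y) (inr ρ′) (inr μ)) = 0` — off the coarse sublattice the rows vanish
(`coDressKBmAt_KInvStep_inr_row_off`), on it this is an1's `colM_coDressKBmAt_KInvStep_ward`. -/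
theorem mulRow_coclosed_coDressKBmAt_KInvStep (ρ : Fin (d + 1) → ℤ) (j : ℕ) (v y : Fin (d + 1) → ℤ) (ρ' : Fin (d + 1)) :
    ∑ μ, (coDressKBmAt ρ Lc (KInvStep (d := d) Lc j) v ((Lc : ℤ) • (y - unitVec μ)) (Sum.inr ρ') (Sum.inr μ)
      - coDressKBmAt ρ Lc (KInvStep (d := d) Lc j) v ((Lc : ℤ) • y) (Sum.inr ρ') (Sum.inr μ)) = 0 := by
  rcases eq_or_ne (Torus.proj Lc v) 0 with hv | hv
  · have h := colM_coDressKBmAt_KInvStep_ward (Lc := Lc) ρ j y ρ' (quo Lc v)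
    simp only [SecondOrderResponse.colM] at h
    rw [← eq_zsmul_quo_of_proj hv] at h
    exact h
  · have h0 : ∀ (z : Fin (d + 1) → ℤ) (m : Fin (d + 1)) (b : Fib d), coDressKBmAt ρ Lc (KInvStep (d := d) Lc j) v z (Sum.inr m) b = 0 :=
      fun z m b => coDressKBmAt_KInvStep_inr_row_off ρ j hv z m b
    simp only [h0, sub_zero, Finset.sum_const_zero]

/-- [folklore] **THE OUTER-LEG PULL-BACK THROUGH THE WALL PROPAGATOR**, every step `j`, every in-block root `r`, every tame `A`:
`Σ_μ ((A∘G_j) x (Lc•(y − e_μ)) a (inr μ) − (A∘G_j) x (Lc•y) a (inr μ)) = (stepScale d Lc j·Lc^{d+1})⁻¹ · Σ'_v Σ_κ′ A x v a (inl κ′)·gaugeWt Lc y κ′ v`. -/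
theorem mulLeg_coarseDiv_comp_coDressKBmAt_KInvStep (hr : r ∈ box (d + 1) Lc) (j : ℕ) {A : MKer (d + 1) (Fib d)} (hA : Tame A)
    (x : Fin (d + 1) → ℤ) (a : Fib d) (y : Fin (d + 1) → ℤ) :
    ∑ μ, (comp A (coDressKBmAt (toSite r) Lc (KInvStep (d := d) Lc j)) x ((Lc : ℤ) • (y - unitVec μ)) a (Sum.inr μ)
      - comp A (coDressKBmAt (toSite r) Lc (KInvStep (d := d) Lc j)) x ((Lc : ℤ) • y) a (Sum.inr μ)) =
      (stepScale d Lc j * (Lc : ℝ) ^ (d + 1))⁻¹ * ∑' v, ∑ κ', A x v a (Sum.inl κ') * gaugeWt Lc y κ' v := by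
  have hG : Spr (coDressKBmAt (toSite r) Lc (KInvStep (d := d) Lc j)) :=
    spr_coDressKBmAt (one_le_of_neZero Lc) hr (spr_KInvStep j)
  exact mulLeg_coarseDiv_comp_right hA hG.tame (fun y' κ' u => colH_ward_KInvStep_all hr j y' κ' u)
    (fun v y' ρ' => mulRow_coclosed_coDressKBmAt_KInvStep (toSite r) j v y' ρ') x a y

end Wall

/-! ## §3 The second bond-derivative of a packed resolvent: sandwich form and the kernel-leg pull-back of its `mm`-read -/

section Sandwich

/-- [folklore] `K2OfK K N S M b = −(K ∘ dM_b ∘ K)` as kernels (the definition, `funext`; = `GAN24.ExchangeReadout.K2OfK_eq_neg` ∕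
`GAN24.EvenTowerAutonomy.K2OfK_eq_neg_sandwich`, restated `private` by `rfl` to keep this file's import cone at the column laws). -/
private theorem K2OfK_eq_neg (K : MKer (d + 1) (Fib d)) (N : ℕ) (S M : Fin (d + 1) → (Fin (d + 1) → ℤ) → MKer (d + 1) (Fib d))
    (ν : Fin (d + 1)) (y' : Fin (d + 1) → ℤ) :
    K2OfK K N S M ν y' = -(comp (comp K (dM K N S M ν y')) K) := by
  funext x z a b; rfl

/-- [folklore] `K3OfK` as the alternating sum of its three words, as kernels (the definition, `funext`; = `WardLocusQuartic.K3OfK_eq` ∕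
`GAN24.EvenTowerAutonomy.K3OfK_eq`, restated `private` by `rfl` for the same reason). -/
private theorem K3OfK_eq_words (K : MKer (d + 1) (Fib d)) (N : ℕ) (S M : Fin (d + 1) → (Fin (d + 1) → ℤ) → MKer (d + 1) (Fib d))
    (W : Fin (d + 1) → (Fin (d + 1) → ℤ) → Fin (d + 1) → (Fin (d + 1) → ℤ) → MKer (d + 1) (Fib d))
    (μ : Fin (d + 1)) (y : Fin (d + 1) → ℤ) (ν : Fin (d + 1)) (y' : Fin (d + 1) → ℤ) :
    K3OfK K N S M W μ y ν y' =
      -(comp (comp K (dM K N S M μ y)) (K2OfK K N S M ν y')) - comp (comp K (dM K N S M ν y')) (K2OfK K N S M μ y)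
        - comp (comp K (W μ y ν y')) K := by
  funext x z a b; rfl

/-- [folklore] **THE SANDWICH FORM OF `K3OfK`**: for a spread `K` and localised `dM_b`, `dM_{b′}`, `W_{bb′}`,
`K3OfK K N S M W b b′ = K ∘ (dM_b ∘ K ∘ dM_{b′} + dM_{b′} ∘ K ∘ dM_b − W_{bb′}) ∘ K` — every kernel leg of `∂_b∂_{b′}(𝕄⁻¹)` is an OUTER leg of `K`
(`comp_neg_right`, three `comp_assoc_tame` per word, `comp_add∕sub_left∕right_tame`). -/
theorem K3OfK_eq_sandwich {K : MKer (d + 1) (Fib d)} (hK : Spr K) (N : ℕ)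
    (S M : Fin (d + 1) → (Fin (d + 1) → ℤ) → MKer (d + 1) (Fib d))
    (W : Fin (d + 1) → (Fin (d + 1) → ℤ) → Fin (d + 1) → (Fin (d + 1) → ℤ) → MKer (d + 1) (Fib d))
    (μ : Fin (d + 1)) (y : Fin (d + 1) → ℤ) (ν : Fin (d + 1)) (y' : Fin (d + 1) → ℤ)
    (hDμ : Loc (dM K N S M μ y)) (hDν : Loc (dM K N S M ν y')) (hW : Loc (W μ y ν y')) :
    K3OfK K N S M W μ y ν y' =
      comp (comp K (comp (comp (dM K N S M μ y) K) (dM K N S M ν y') + comp (comp (dM K N S M ν y') K) (dM K N S M μ y)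
        - W μ y ν y')) K := by
  have tK : Tame K := hK.tame
  have tDμ : Tame (dM K N S M μ y) := hDμ.tame
  have tDν : Tame (dM K N S M ν y') := hDν.tame
  have lKDμ : Loc (comp K (dM K N S M μ y)) := hK.comp_loc hDμ
  have lKDν : Loc (comp K (dM K N S M ν y')) := hK.comp_loc hDν
  have lDμK : Loc (comp (dM K N S M μ y) K) := hDμ.comp_spr hK
  have lDνK : Loc (comp (dM K N S M ν y') K) := hDν.comp_spr hK
  have lY₁ : Loc (comp (comp (dM K N S M μ y) K) (dM K N S M ν y')) := lDμK.comp hDν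
  have lY₂ : Loc (comp (comp (dM K N S M ν y') K) (dM K N S M μ y)) := lDνK.comp hDμ
  have w1 : comp (comp K (dM K N S M μ y)) (K2OfK K N S M ν y') =
      -(comp (comp K (comp (comp (dM K N S M μ y) K) (dM K N S M ν y'))) K) := by
    rw [K2OfK_eq_neg, comp_neg_right, comp_assoc_tame lKDμ.tame lKDν.tame tK,
      comp_assoc_tame lKDμ.tame tK tDν, ← comp_assoc_tame tK tDμ tK, ← comp_assoc_tame tK lDμK.tame tDν]
  have w2 : comp (comp K (dM K N S M ν y')) (K2OfK K N S M μ y) =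
      -(comp (comp K (comp (comp (dM K N S M ν y') K) (dM K N S M μ y))) K) := by
    rw [K2OfK_eq_neg, comp_neg_right, comp_assoc_tame lKDν.tame lKDμ.tame tK,
      comp_assoc_tame lKDν.tame tK tDμ, ← comp_assoc_tame tK tDν tK, ← comp_assoc_tame tK lDνK.tame tDμ]
  rw [K3OfK_eq_words, w1, w2, neg_neg, sub_neg_eq_add,
    comp_sub_right_tame tK (lY₁.add lY₂).tame hW.tame, comp_add_right_tame tK lY₁.tame lY₂.tame,
    comp_sub_left_tame ((hK.comp_loc lY₁).add (hK.comp_loc lY₂)).tame (hK.comp_loc hW).tame tK,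
    comp_add_left_tame (hK.comp_loc lY₁).tame (hK.comp_loc lY₂).tame tK]

variable {Lc : ℕ} [NeZero Lc] {r : Fin (d + 1) → ℕ}

/-- [folklore] **THE KERNEL-LEG PULL-BACK OF THE SECOND BOND-DERIVATIVE READ-OUT THROUGH THE WALL PROPAGATOR** (every step `j`, in-block root `r`,
localised `dM_b`, `dM_{b′}`, `W_{bb′}`): with `G_j := coDressKBmAt (toSite r) Lc (KInvStep Lc j)` and the interior
`Y := dM_b∘G_j∘dM_{b′} + dM_{b′}∘G_j∘dM_b − W_{bb′}`, the coarse divergence of the right KERNEL leg of `mmRead Lc (K3OfK G_j Lc S M W b b′)` — an2's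
`e4OfKW Lc G_j S M W b b′` (`SpineRecursiveW.e4OfKW`, `rfl`), the E-sector of `T2RecAt (j+1)` up to its weight — is the fine block pure gauge on the
right FIELD leg of `G_j ∘ Y`, times the column Ward constant `(stepScale d Lc j·Lc^{d+1})⁻¹`:
`Σ_β (mmRead Lc (K3OfK G_j …) x′ (y − e_β) (inl α) (inl β) − mmRead Lc (K3OfK G_j …) x′ y (inl α) (inl β))
 = (stepScale d Lc j·Lc^{d+1})⁻¹ · Σ'_v Σ_κ′ (G_j ∘ Y) (Lc•x′) v (inr α) (inl κ′)·gaugeWt Lc y κ′ v`. -/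
theorem mmRead_K3OfK_kernelLeg_coarseDiv (hr : r ∈ box (d + 1) Lc) (j : ℕ)
    (S M : Fin (d + 1) → (Fin (d + 1) → ℤ) → MKer (d + 1) (Fib d))
    (W : Fin (d + 1) → (Fin (d + 1) → ℤ) → Fin (d + 1) → (Fin (d + 1) → ℤ) → MKer (d + 1) (Fib d))
    (μ : Fin (d + 1)) (yb : Fin (d + 1) → ℤ) (ν : Fin (d + 1)) (yb' : Fin (d + 1) → ℤ)
    (hDμ : Loc (dM (coDressKBmAt (toSite r) Lc (KInvStep (d := d) Lc j)) Lc S M μ yb))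
    (hDν : Loc (dM (coDressKBmAt (toSite r) Lc (KInvStep (d := d) Lc j)) Lc S M ν yb'))
    (hW : Loc (W μ yb ν yb')) (x' : Fin (d + 1) → ℤ) (α : Fin (d + 1)) (y : Fin (d + 1) → ℤ) :
    ∑ β, (mmRead Lc (K3OfK (coDressKBmAt (toSite r) Lc (KInvStep (d := d) Lc j)) Lc S M W μ yb ν yb') x' (y - unitVec β) (Sum.inl α) (Sum.inl β)
      - mmRead Lc (K3OfK (coDressKBmAt (toSite r) Lc (KInvStep (d := d) Lc j)) Lc S M W μ yb ν yb') x' y (Sum.inl α) (Sum.inl β)) =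
      (stepScale d Lc j * (Lc : ℝ) ^ (d + 1))⁻¹ *
        ∑' v, ∑ κ', comp (coDressKBmAt (toSite r) Lc (KInvStep (d := d) Lc j))
          (comp (comp (dM (coDressKBmAt (toSite r) Lc (KInvStep (d := d) Lc j)) Lc S M μ yb) (coDressKBmAt (toSite r) Lc (KInvStep (d := d) Lc j)))
              (dM (coDressKBmAt (toSite r) Lc (KInvStep (d := d) Lc j)) Lc S M ν yb') +
            comp (comp (dM (coDressKBmAt (toSite r) Lc (KInvStep (d := d) Lc j)) Lc S M ν yb') (coDressKBmAt (toSite r) Lc (KInvStep (d := d) Lc j)))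
              (dM (coDressKBmAt (toSite r) Lc (KInvStep (d := d) Lc j)) Lc S M μ yb) - W μ yb ν yb')
          ((Lc : ℤ) • x') v (Sum.inr α) (Sum.inl κ') * gaugeWt Lc y κ' v := by
  set G := coDressKBmAt (toSite r) Lc (KInvStep (d := d) Lc j) with hGdef
  have hG : Spr G := spr_coDressKBmAt (one_le_of_neZero Lc) hr (spr_KInvStep j)
  set Y := comp (comp (dM G Lc S M μ yb) G) (dM G Lc S M ν yb') + comp (comp (dM G Lc S M ν yb') G) (dM G Lc S M μ yb) - W μ yb ν yb' with hYdef
  have hY : Loc Y := (((hDμ.comp_spr hG).comp hDν).add ((hDν.comp_spr hG).comp hDμ)).sub hW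
  have hA : Tame (comp G Y) := (hG.comp_loc hY).tame
  simp only [mmRead_inl_inl, K3OfK_eq_sandwich hG Lc S M W μ yb ν yb' hDμ hDν hW]
  exact mulLeg_coarseDiv_comp_coDressKBmAt_KInvStep hr j hA ((Lc : ℤ) • x') (Sum.inr α) y

end Sandwich

end

end Summit.QuantumFields.BalabanUV.Beta.KernelLegPullback
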